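import Summits.HodgeConjecture.HodgeConjecture.Theorems.PadicSemiregularLiftHodgeBeyondAnchorsReductions
import Summits.HodgeConjecture.HodgeConjecture.Theorems.PadicSemiregularLiftHodgeBeyondAnchorsProductDescent
import Summits.HodgeConjecture.HodgeConjecture.Theorems.PadicSemiregularLiftHodgeBeyondAnchorsProductsNotAnchors

/-!
# `HodgeBeyondAnchors` is the whole Hodge conjecture (modulo three named facts)

Route `PadicSemiregularLift` of `HodgeConjecture`, support item `HodgeBeyondAnchors`
(stmt-HodgeConjecture-14054): the Hodge conjecture for every smooth projective complex variety that
is NOT an anchor (not `A.X` for an abelian variety `A` of that dimension, not a Fermat hypersurface).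
The sibling file `…Reductions` proved `HodgeConjecture ↔ anchors ∧ HodgeBeyondAnchors`
unconditionally. This file proves that the anchors are NOT separated by the complement form:

* `hodgeConjecture_of_hodgeBeyondAnchors` — **`HodgeBeyondAnchors → HodgeConjecture`**, granted the
  tree's named facts `nonempty_hodgeModel` (Hodge models exist), `hodgePQ_independent_of_hodgeModel`
  (Hodge types do not depend on the model) and the fact
  `Milne1986_projectiveLine_to_abelianVariety_const` (Milne, *Abelian Varieties* §3 Cor. 3.8:
  abelian varieties contain no rational curves). For `X` smooth projective of dimension `n ≥ 1`,
  `Y = X × ℙ¹ × ℙ¹` is smooth projective (Segre, the tree's `IsSmoothProjective.tensor_holds`),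
  not an abelian variety and not a Fermat variety (`…ProductsNotAnchors`), so the item yields
  `HC(Y)`, which descends to `X` (`…ProductDescent`); `n = 0` is the extreme-codimension case;
* `hodgeBeyondAnchors_iff_hodgeConjecture`, `anchors_of_hodgeBeyondAnchors` — hence, modulo the
  same facts, the item is EQUIVALENT to the summit and IMPLIES the route's crux output items
  `HodgeAbelianVarieties` (rank 4) and `HodgeFermatVarieties` (rank 5).

Reading for the planner: as typed, the rank-6 "placeholder" carries the entire summit; any
restatement in complement form must exclude a class of varieties closed under `– × ℙ¹` (or under
the descent `HC(X × ℙ¹) ⇒ HC(X)`) to separate anything.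

References: J. S. Milne, *Abelian Varieties* (Cornell–Silverman 1986), §3 Cor. 3.8 (p. 107);
P. Deligne, *The Hodge conjecture* (Clay 2000), §1; W. Fulton, *Intersection Theory* (1998), §10.1;
C. Voisin, *Hodge Theory and Complex Algebraic Geometry II* (2003), Thm. 1.23.
-/

set_option linter.dupNamespace false

noncomputable section

open CategoryTheory AlgebraicGeometry MonoidalCategory CartesianMonoidalCategory Topology
open Literature.AlgebraicTopology.SingularHomology
open Literature.AlgebraicGeometry Literature.AlgebraicGeometry.HodgeTheory
  Literature.AlgebraicGeometry.Motives

namespace Summit.HodgeConjecture.HodgeConjecture.Theorems.HodgeBeyondAnchors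

/-! ## The item is the whole Hodge conjecture -/

section Equivalence

open Summit.HodgeConjecture.HodgeConjecture.Theses.PadicSemiregularLift

/-- A non-zero class in `H²(ℙ¹(ℂ); ℂ) ≅ ℂ`. [cite: HatcherAT2002, Thm. 3.19] -/
theorem exists_ne_zero_complexBetti_projectiveSpace_one :
    ∃ h : complexBetti (projectiveSpace 1 ℂ) 2, h ≠ 0 := by
  have hfr : Module.finrank ℂ (complexBetti (projectiveSpace 1 ℂ) (2 * 1)) = 1 :=
    finrank_complexBetti_projectiveSpace_two_mul_eq_one 1 le_rfl
  obtain ⟨g, hg, -⟩ := finrank_eq_one_iff'.1 hfr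
  exact ⟨g, hg⟩

/-- **The support item `HodgeBeyondAnchors` implies the full Hodge conjecture**, granted three
standard named facts of the tree: Hodge models exist (`nonempty_hodgeModel`, Serre GAGA + de Rham +
Hodge decomposition), Hodge types do not depend on the model (`hodgePQ_independent_of_hodgeModel`),
and abelian varieties contain no rational curves (`Milne1986_projectiveLine_to_abelianVariety_const`,
Milne Cor. 3.8). For `X` smooth projective of dimension `n ≥ 1`, `Y = X × ℙ¹ × ℙ¹` is smooth
projective of dimension `n + 2` and is NEITHER an abelian variety (it contains the rational curves
`{y} × ℙ¹`) NOR a Fermat hypersurface (`b₂(Y) ≥ 2`, against Lefschetz), so the item gives `HC(Y)`,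
which descends to `X` along the two projections (`hodgeConjectureFor_of_tensor_tensor`); `n = 0` is
the extreme-codimension case. So the complement-of-anchors form does not separate the anchors from
"the rest": the rank-6 support item already carries the rank-4/5 cruxes and the summit.
[cite: Milne1986AbelianVarieties, §3 Cor. 3.8 (p. 107)] [cite: VoisinHodgeII2003, §1.2.2 Thm. 1.23]
[cite: Fulton1998, §10.1, Example 10.1.2] -/
theorem hodgeConjecture_of_hodgeBeyondAnchors
    (hM : ∀ (n : ℕ) (X : SchemeOver ℂ), nonempty_hodgeModel n X)
    (hI : hodgePQ_independent_of_hodgeModel)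
    (hNRC : Milne1986_projectiveLine_to_abelianVariety_const.{0})
    (h : HodgeBeyondAnchors) : _root_.HodgeConjecture := by
  intro n X hX
  rcases Nat.eq_zero_or_pos n with rfl | hn
  · exact ⟨hM 0 X hX, fun p c _ _ ↦ mem_algebraicClasses_of_extreme hX (by omega) c⟩
  have hL : IsSmoothProjective 1 (projectiveSpace 1 ℂ) := isSmoothProjective_projectiveSpace_holds ℂ 1
  haveI : Infinite (ComplexPoints (projectiveSpace 1 ℂ)) := infinite_complexPoints_projectiveSpace_one
  have hXL : IsSmoothProjective (n + 1) (X ⊗ projectiveSpace 1 ℂ) :=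
    Motives.IsSmoothProjective.tensor_holds hX hL
  have hXLL : IsSmoothProjective (n + 1 + 1) ((X ⊗ projectiveSpace 1 ℂ) ⊗ projectiveSpace 1 ℂ) :=
    Motives.IsSmoothProjective.tensor_holds hXL hL
  obtain ⟨c, hc⟩ := exists_ne_zero_complexBetti_projectiveSpace_one
  have hY : HodgeConjectureFor (n + 1 + 1) ((X ⊗ projectiveSpace 1 ℂ) ⊗ projectiveSpace 1 ℂ) :=
    h hXLL (fun A _ ↦ abelianVariety_X_ne_tensor_tensor hNRC hX A)
      (fun m ↦ not_isFermatVariety_tensor_tensor hX hn hL hc m)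
  exact hodgeConjectureFor_of_tensor_tensor hI hX hL (hM n X hX) (hM _ _ hXL) hY

/-- **`HodgeBeyondAnchors ↔ HodgeConjecture`** modulo the three named facts (`←` is restriction of
the summit to non-anchors, unconditionally). [cite: Deligne2000, §1]
[cite: Milne1986AbelianVarieties, §3 Cor. 3.8 (p. 107)] -/
theorem hodgeBeyondAnchors_iff_hodgeConjecture
    (hM : ∀ (n : ℕ) (X : SchemeOver ℂ), nonempty_hodgeModel n X)
    (hI : hodgePQ_independent_of_hodgeModel)
    (hNRC : Milne1986_projectiveLine_to_abelianVariety_const.{0}) :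
    HodgeBeyondAnchors ↔ _root_.HodgeConjecture :=
  ⟨hodgeConjecture_of_hodgeBeyondAnchors hM hI hNRC, fun H _ _ hX _ _ ↦ H hX⟩

/-- **The support item implies the route's two crux OUTPUT items** `HodgeAbelianVarieties` (rank 4)
and `HodgeFermatVarieties` (rank 5), modulo the same three named facts: the typed output layer of
route `PadicSemiregularLift` is carried entirely by its rank-6 "placeholder".
[cite: Milne1986AbelianVarieties, §3 Cor. 3.8 (p. 107)] [cite: Deligne2000, §1] -/
theorem anchors_of_hodgeBeyondAnchors
    (hM : ∀ (n : ℕ) (X : SchemeOver ℂ), nonempty_hodgeModel n X)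
    (hI : hodgePQ_independent_of_hodgeModel)
    (hNRC : Milne1986_projectiveLine_to_abelianVariety_const.{0}) (h : HodgeBeyondAnchors) :
    HodgeAbelianVarieties ∧ HodgeFermatVarieties :=
  have H := hodgeConjecture_iff_anchors_and_beyond.1 (hodgeConjecture_of_hodgeBeyondAnchors hM hI hNRC h)
  ⟨H.1, H.2.1⟩

end Equivalence

end Summit.HodgeConjecture.HodgeConjecture.Theorems.HodgeBeyondAnchors

end
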